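import Mathlib
import HarnessLib
import Summits.NavierStokesRegularity.NavierStokesRegularity.Theorems.LocalSineTubeDoorProfileAlignedWindowRigidityAncient
import Summits.NavierStokesRegularity.NavierStokesRegularity.Theorems.PoloidalWindowDoorPoloidalWindowRigidityHorizontalSourceGauge

/-!
# Crux K2 `PoloidalWindowRigidity` (stmt-NavierStokesRegularity-19708), line `z_shock` — the `hdense` / `hpocket` split of the
# THICK hyperbolic column, read through slice analyticity: «NO STRICTLY ELLIPTIC POINT» versus «A STRICTLY ELLIPTIC BALL»

`--supports stmt-NavierStokesRegularity-19708 --as helper` (leafhand-ns-poloidalwindowdoor-3 g1, cell decomp-ns, 2026-08-31).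
**No stub and no summit is closed by this file; Navier–Stokes regularity is NOT proved here.**

The registered skeleton `Cruxes/PoloidalWindowRigidity/Lines/z_shock.lean` (sha16 c3e8eee2) cuts the thick hyperbolic twisting column by
the predicate `Dense {y | E(t,y) < 0}` on ONE window-time slice, where
`E(t,y) := ∂₂v₀(t,y)·∂₀v₂(t,y) + ∂₂v₁(t,y)·∂₁v₂(t,y)` is the hyperbolicity discriminant of the height-evolution (`E < 0` hyperbolic,
`E > 0` elliptic): `stub_zShockThickAut` / `stub_zShockThickMod` carry `hdense : Dense {E(t₀,·) < 0}` at a window point `z₀ = (t₀,x₀)`,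
the residue `stub_mixedPocketThick` carries `hpocket : ∀ z ∈ W, ¬ Dense {E(z.1,·) < 0}`.  Because class slices are real-analytic
(tree `…LocalSineTubeDoorProfileAlignedWindowRigidityAncient.analyticOnNhd_slice`) and the window supplies one strictly hyperbolic point on
each window-time slice, both predicates have an elementary pointwise meaning, recorded here so that the next reshape / R3 prover can use them
without the topology:

* `nonpos_of_dense_setOf_neg` (any topological space, `E` continuous): `Dense {E < 0} → ∀ y, E y ≤ 0`.
* `dense_setOf_neg_of_nonpos` (real-analytic `E` on a real normed space, one point with `E < 0`): `(∀ y, E y ≤ 0) → Dense {E < 0}`;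
  together `dense_setOf_neg_iff_nonpos`: **`hdense` ⟺ the slice has NO strictly elliptic point** (`E(t₀,·) ≤ 0` on all of `ℝ³`).
* `exists_ball_pos_of_not_dense_setOf_neg` (real-analytic `E`, one point with `E < 0`): `¬ Dense {E < 0}` ⟹ `E > 0` on an open BALL —
  **`hpocket` ⟺ every window-time slice carries a STRICTLY ELLIPTIC BALL** (not merely a semi-elliptic one: a semi-elliptic ball on which
  `E` vanished identically would force `E ≡ 0` on the slice by the identity theorem, against the hyperbolic window point).
* Class entries (binders VERBATIM from the stubs: Type-I rate, continuity on the slab, Oseen identity (M)):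
  `analyticOnNhd_hypDiscriminant_slice` (the discriminant is real-analytic on every slice `t < 0`),
  `hypDiscriminant_nonpos_of_dense` / `dense_of_hypDiscriminant_nonpos` (the deciding stub's `hdense` read pointwise and back),
  `exists_ellipticBall_of_not_dense` (one window time), `exists_ellipticBall_of_pocket` (the residue stub's `hpocket` on the whole
  window: at every window time an open ball of `ℝ³` is strictly elliptic while the window point is strictly hyperbolic — the slice is of
  genuinely MIXED type with both signs realised on open sets).

HONEST LABEL: S-sized reading aid for the skeleton's split (the deciding stub's slice is «hyperbolic-or-degenerate everywhere», the residue's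
slices are «Tricomi slices with an open elliptic region»); closes no stub; R3 (two-sided eternal rigidity of the autonomous genuinely
nonlinear height-evolution), R5 and the mixed-type free-boundary statement stay OPEN; crux 19708 OPEN.  presearch: elementary
(identity theorem for real-analytic functions, `AnalyticOnNhd.eqOn_zero_of_preconnected_of_eventuallyEq_zero`); nothing to cite. [folklore]
-/

noncomputable section

namespace Summit.NavierStokesRegularity.NavierStokesRegularity.Theorems.PoloidalWindowDoorPoloidalWindowRigidityZShockEllipticPocket

-- the problem directory repeats the summit name (`NavierStokesRegularity/NavierStokesRegularity`)
set_option linter.dupNamespace false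

open Set Filter Topology Function Metric
open Literature.Analysis Literature.Analysis.FluidPDE
open Summit.NavierStokesRegularity.NavierStokesRegularity.Theorems.LocalSineTubeDoorProfileAlignedWindowRigidityAncient
open Summit.NavierStokesRegularity.NavierStokesRegularity.Theorems.PoloidalWindowDoorPoloidalWindowRigidityHorizontalSourceGauge
  (analyticOnNhd_fderiv_apply_coord)

/-! ## Class-free: the sign set of a continuous / real-analytic function -/

/-- If the strict sublevel set `{E < 0}` of a continuous function is dense, then `E ≤ 0` everywhere. [folklore] -/
theorem nonpos_of_dense_setOf_neg {X : Type*} [TopologicalSpace X] {E : X → ℝ} (hE : Continuous E)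
    (hD : Dense {y | E y < 0}) (y : X) : E y ≤ 0 := by
  have hcl : closure {y | E y < 0} ⊆ {y | E y ≤ 0} :=
    (isClosed_le hE continuous_const).closure_subset_iff.2 fun z hz => by
      simp only [mem_setOf_eq] at hz ⊢
      exact le_of_lt hz
  exact hcl (hD y)

/-- For a real-analytic `E` on a real normed space with `E ≤ 0` everywhere and ONE point where `E < 0`, the set `{E < 0}` is dense:
otherwise `E` vanishes on a nonempty open set, hence identically (identity theorem), contradicting the negative point. [folklore] -/
theorem dense_setOf_neg_of_nonpos {F : Type*} [NormedAddCommGroup F] [NormedSpace ℝ F] {E : F → ℝ}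
    (hE : AnalyticOnNhd ℝ E univ) (hle : ∀ y, E y ≤ 0) (hx : ∃ x₀, E x₀ < 0) : Dense {y | E y < 0} := by
  rw [dense_iff_inter_open]
  intro U hU hUne
  by_contra hempty
  rw [not_nonempty_iff_eq_empty] at hempty
  obtain ⟨y₁, hy₁⟩ := hUne
  have hzero : ∀ y ∈ U, E y = 0 := fun y hy => by
    have h1 : ¬ E y < 0 := fun hlt => by
      have hmem : y ∈ U ∩ {y | E y < 0} := ⟨hy, hlt⟩
      rw [hempty] at hmem
      exact hmem
    exact le_antisymm (hle y) (not_lt.1 h1)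
  have hev : E =ᶠ[𝓝 y₁] 0 := by
    filter_upwards [hU.mem_nhds hy₁] with y hy
    exact hzero y hy
  have hE0 : EqOn E 0 univ :=
    hE.eqOn_zero_of_preconnected_of_eventuallyEq_zero (convex_univ.isPreconnected) (mem_univ y₁) hev
  obtain ⟨x₀, hx₀⟩ := hx
  have h0 : E x₀ = 0 := hE0 (mem_univ x₀)
  linarith

/-- **`Dense {E < 0}` ⟺ no point with `E > 0`**, for a real-analytic `E` with one negative point. [folklore] -/
theorem dense_setOf_neg_iff_nonpos {F : Type*} [NormedAddCommGroup F] [NormedSpace ℝ F] {E : F → ℝ}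
    (hE : AnalyticOnNhd ℝ E univ) (hx : ∃ x₀, E x₀ < 0) : Dense {y | E y < 0} ↔ ∀ y, E y ≤ 0 :=
  ⟨fun hD => nonpos_of_dense_setOf_neg hE.continuous hD, fun hle => dense_setOf_neg_of_nonpos hE hle hx⟩

/-- **A strictly positive BALL from non-density.**  For a real-analytic `E` with one negative point, if `{E < 0}` is NOT dense then
`E > 0` on some open ball: the open set missed by `{E < 0}` carries `E ≥ 0`, `E` cannot vanish identically there (identity theorem and
the negative point), so it is positive somewhere, hence on a ball by continuity. [folklore] -/
theorem exists_ball_pos_of_not_dense_setOf_neg {F : Type*} [NormedAddCommGroup F] [NormedSpace ℝ F] {E : F → ℝ}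
    (hE : AnalyticOnNhd ℝ E univ) (hx : ∃ x₀, E x₀ < 0) (hnd : ¬ Dense {y | E y < 0}) :
    ∃ c : F, ∃ r : ℝ, 0 < r ∧ ∀ y ∈ ball c r, 0 < E y := by
  -- an open nonempty set missed by `{E < 0}`
  have hU : ∃ U : Set F, IsOpen U ∧ U.Nonempty ∧ U ∩ {y | E y < 0} = ∅ := by
    by_contra h
    refine hnd (dense_iff_inter_open.2 fun U hU hne => ?_)
    by_contra hne'
    exact h ⟨U, hU, hne, not_nonempty_iff_eq_empty.1 hne'⟩
  obtain ⟨U, hUo, hUne, hUS⟩ := hU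
  have hnn : ∀ y ∈ U, 0 ≤ E y := fun y hy => by
    by_contra hlt
    have hmem : y ∈ U ∩ {y | E y < 0} := ⟨hy, not_le.1 hlt⟩
    rw [hUS] at hmem
    exact hmem
  -- `E` is not identically zero on `U`
  have hne : ∃ y₁ ∈ U, E y₁ ≠ 0 := by
    by_contra h
    push Not at h
    obtain ⟨y₁, hy₁⟩ := hUne
    have hev : E =ᶠ[𝓝 y₁] 0 := by
      filter_upwards [hUo.mem_nhds hy₁] with y hy
      exact h y hy
    have hE0 : EqOn E 0 univ :=
      hE.eqOn_zero_of_preconnected_of_eventuallyEq_zero (convex_univ.isPreconnected) (mem_univ y₁) hev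
    obtain ⟨x₀, hx₀⟩ := hx
    have h0 : E x₀ = 0 := hE0 (mem_univ x₀)
    linarith
  obtain ⟨y₁, hy₁U, hy₁⟩ := hne
  have hpos : 0 < E y₁ := lt_of_le_of_ne (hnn y₁ hy₁U) (Ne.symm hy₁)
  have hc : ContinuousAt E y₁ := (hE y₁ (mem_univ _)).continuousAt
  have hev : ∀ᶠ y in 𝓝 y₁, 0 < E y := hc.eventually (Ioi_mem_nhds hpos)
  obtain ⟨r, hr, hball⟩ := Metric.eventually_nhds_iff_ball.1 hev
  exact ⟨y₁, r, hr, fun y hy => hball y hy⟩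

/-! ## Class entries: the hyperbolicity discriminant of a class slice -/

/-- **The discriminant `E(t,·) = ∂₂v₀·∂₀v₂ + ∂₂v₁·∂₁v₂` of a class slice is real-analytic on `ℝ³`** (Type-I rate + continuity on the
slab + the Oseen identity ⇒ analytic slices; first-derivative entries of an analytic field are analytic). [folklore] -/
theorem analyticOnNhd_hypDiscriminant_slice {C : ℝ} {v : ℝ → EuclideanSpace ℝ (Fin 3) → EuclideanSpace ℝ (Fin 3)}
    (hrate : HasTypeITimeDecay C v) (hcont : ContinuousOn (uncurry v) (Iio (0 : ℝ) ×ˢ univ))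
    (hmild : ∀ s t : ℝ, s < t → t < 0 → ∀ x, v t x =
      UnboundedOperators.heatExtension (v s) (t - s) x - oseenDuhamel 1 s v v t x)
    {t : ℝ} (ht : t < 0) :
    AnalyticOnNhd ℝ (fun y : EuclideanSpace ℝ (Fin 3) =>
      fderiv ℝ (v t) y (EuclideanSpace.single 2 1) 0 * fderiv ℝ (v t) y (EuclideanSpace.single 0 1) 2 +
        fderiv ℝ (v t) y (EuclideanSpace.single 2 1) 1 * fderiv ℝ (v t) y (EuclideanSpace.single 1 1) 2) univ := by
  have hV : AnalyticOnNhd ℝ (v t) univ := analyticOnNhd_slice hcont (bdd_of_hasTypeITimeDecay hrate) hmild ht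
  exact ((analyticOnNhd_fderiv_apply_coord hV _ 0).mul (analyticOnNhd_fderiv_apply_coord hV _ 2)).add
    ((analyticOnNhd_fderiv_apply_coord hV _ 1).mul (analyticOnNhd_fderiv_apply_coord hV _ 2))

/-- **The deciding stub's `hdense` read pointwise: a densely hyperbolic class slice has NO strictly elliptic point** (`E(t,y) ≤ 0` for
every `y ∈ ℝ³`). [folklore] -/
theorem hypDiscriminant_nonpos_of_dense {C : ℝ} {v : ℝ → EuclideanSpace ℝ (Fin 3) → EuclideanSpace ℝ (Fin 3)}
    (hrate : HasTypeITimeDecay C v) (hcont : ContinuousOn (uncurry v) (Iio (0 : ℝ) ×ˢ univ))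
    (hmild : ∀ s t : ℝ, s < t → t < 0 → ∀ x, v t x =
      UnboundedOperators.heatExtension (v s) (t - s) x - oseenDuhamel 1 s v v t x)
    {t : ℝ} (ht : t < 0)
    (hdense : Dense {y : EuclideanSpace ℝ (Fin 3) |
      fderiv ℝ (v t) y (EuclideanSpace.single 2 1) 0 * fderiv ℝ (v t) y (EuclideanSpace.single 0 1) 2 +
        fderiv ℝ (v t) y (EuclideanSpace.single 2 1) 1 * fderiv ℝ (v t) y (EuclideanSpace.single 1 1) 2 < 0}) :
    ∀ y : EuclideanSpace ℝ (Fin 3),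
      fderiv ℝ (v t) y (EuclideanSpace.single 2 1) 0 * fderiv ℝ (v t) y (EuclideanSpace.single 0 1) 2 +
        fderiv ℝ (v t) y (EuclideanSpace.single 2 1) 1 * fderiv ℝ (v t) y (EuclideanSpace.single 1 1) 2 ≤ 0 :=
  nonpos_of_dense_setOf_neg (analyticOnNhd_hypDiscriminant_slice hrate hcont hmild ht).continuous hdense

/-- **Converse: a class slice with no strictly elliptic point and ONE strictly hyperbolic point is densely hyperbolic** — so inside the
class (with a hyperbolic window point on the slice) `hdense` is EQUIVALENT to «`E(t,·) ≤ 0` on `ℝ³`». [folklore] -/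
theorem dense_of_hypDiscriminant_nonpos {C : ℝ} {v : ℝ → EuclideanSpace ℝ (Fin 3) → EuclideanSpace ℝ (Fin 3)}
    (hrate : HasTypeITimeDecay C v) (hcont : ContinuousOn (uncurry v) (Iio (0 : ℝ) ×ˢ univ))
    (hmild : ∀ s t : ℝ, s < t → t < 0 → ∀ x, v t x =
      UnboundedOperators.heatExtension (v s) (t - s) x - oseenDuhamel 1 s v v t x)
    {t : ℝ} (ht : t < 0)
    (hle : ∀ y : EuclideanSpace ℝ (Fin 3),
      fderiv ℝ (v t) y (EuclideanSpace.single 2 1) 0 * fderiv ℝ (v t) y (EuclideanSpace.single 0 1) 2 +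
        fderiv ℝ (v t) y (EuclideanSpace.single 2 1) 1 * fderiv ℝ (v t) y (EuclideanSpace.single 1 1) 2 ≤ 0)
    (hx : ∃ x₀ : EuclideanSpace ℝ (Fin 3),
      fderiv ℝ (v t) x₀ (EuclideanSpace.single 2 1) 0 * fderiv ℝ (v t) x₀ (EuclideanSpace.single 0 1) 2 +
        fderiv ℝ (v t) x₀ (EuclideanSpace.single 2 1) 1 * fderiv ℝ (v t) x₀ (EuclideanSpace.single 1 1) 2 < 0) :
    Dense {y : EuclideanSpace ℝ (Fin 3) |
      fderiv ℝ (v t) y (EuclideanSpace.single 2 1) 0 * fderiv ℝ (v t) y (EuclideanSpace.single 0 1) 2 +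
        fderiv ℝ (v t) y (EuclideanSpace.single 2 1) 1 * fderiv ℝ (v t) y (EuclideanSpace.single 1 1) 2 < 0} :=
  dense_setOf_neg_of_nonpos (analyticOnNhd_hypDiscriminant_slice hrate hcont hmild ht) hle hx

/-- **The residue stub's `hpocket` at ONE window time: a STRICTLY ELLIPTIC BALL.**  If the slice `t < 0` has a strictly hyperbolic point
and `{E(t,·) < 0}` is not dense, then `E(t,·) > 0` on an open ball of `ℝ³`. [folklore] -/
theorem exists_ellipticBall_of_not_dense {C : ℝ} {v : ℝ → EuclideanSpace ℝ (Fin 3) → EuclideanSpace ℝ (Fin 3)}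
    (hrate : HasTypeITimeDecay C v) (hcont : ContinuousOn (uncurry v) (Iio (0 : ℝ) ×ˢ univ))
    (hmild : ∀ s t : ℝ, s < t → t < 0 → ∀ x, v t x =
      UnboundedOperators.heatExtension (v s) (t - s) x - oseenDuhamel 1 s v v t x)
    {t : ℝ} (ht : t < 0)
    (hx : ∃ x₀ : EuclideanSpace ℝ (Fin 3),
      fderiv ℝ (v t) x₀ (EuclideanSpace.single 2 1) 0 * fderiv ℝ (v t) x₀ (EuclideanSpace.single 0 1) 2 +
        fderiv ℝ (v t) x₀ (EuclideanSpace.single 2 1) 1 * fderiv ℝ (v t) x₀ (EuclideanSpace.single 1 1) 2 < 0)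
    (hnd : ¬ Dense {y : EuclideanSpace ℝ (Fin 3) |
      fderiv ℝ (v t) y (EuclideanSpace.single 2 1) 0 * fderiv ℝ (v t) y (EuclideanSpace.single 0 1) 2 +
        fderiv ℝ (v t) y (EuclideanSpace.single 2 1) 1 * fderiv ℝ (v t) y (EuclideanSpace.single 1 1) 2 < 0}) :
    ∃ c : EuclideanSpace ℝ (Fin 3), ∃ r : ℝ, 0 < r ∧ ∀ y ∈ ball c r,
      0 < fderiv ℝ (v t) y (EuclideanSpace.single 2 1) 0 * fderiv ℝ (v t) y (EuclideanSpace.single 0 1) 2 +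
        fderiv ℝ (v t) y (EuclideanSpace.single 2 1) 1 * fderiv ℝ (v t) y (EuclideanSpace.single 1 1) 2 :=
  exists_ball_pos_of_not_dense_setOf_neg (analyticOnNhd_hypDiscriminant_slice hrate hcont hmild ht) hx hnd

/-- **`stub_mixedPocketThick`'s hypotheses read pointwise (window form).**  Class binders VERBATIM (rate, continuity, (M)), a space–time
window `W ⊆ {t < 0} × ℝ³` on which the slice is strictly hyperbolic (`E < 0`, the stub's `hhyp`), and the residue clause `hpocket`
(`∀ z ∈ W, ¬ Dense {E(z.1,·) < 0}`) ⟹ at EVERY window time `z.1` some open ball of `ℝ³` is STRICTLY ELLIPTIC (`E(z.1,·) > 0`), while the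
window point `z.2` itself is strictly hyperbolic: every window-time slice is of genuinely mixed type, both signs realised on open sets.
(The ND pins, twist, thickness, divergence-freeness and poloidality of the stub are not needed for this reading and are omitted.)
[folklore] -/
theorem exists_ellipticBall_of_pocket (C : ℝ) (v : ℝ → EuclideanSpace ℝ (Fin 3) → EuclideanSpace ℝ (Fin 3))
    (hrate : HasTypeITimeDecay C v) (hcont : ContinuousOn (uncurry v) (Iio (0 : ℝ) ×ˢ univ))
    (hmild : ∀ s t : ℝ, s < t → t < 0 → ∀ x, v t x =
      UnboundedOperators.heatExtension (v s) (t - s) x - oseenDuhamel 1 s v v t x)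
    (W : Set (ℝ × EuclideanSpace ℝ (Fin 3))) (hWs : W ⊆ Iio (0 : ℝ) ×ˢ univ)
    (hhyp : ∀ z ∈ W,
      fderiv ℝ (v z.1) z.2 (EuclideanSpace.single 2 1) 0 * fderiv ℝ (v z.1) z.2 (EuclideanSpace.single 0 1) 2 +
        fderiv ℝ (v z.1) z.2 (EuclideanSpace.single 2 1) 1 * fderiv ℝ (v z.1) z.2 (EuclideanSpace.single 1 1) 2 < 0)
    (hpocket : ∀ z ∈ W, ¬ Dense {y : EuclideanSpace ℝ (Fin 3) |
      fderiv ℝ (v z.1) y (EuclideanSpace.single 2 1) 0 * fderiv ℝ (v z.1) y (EuclideanSpace.single 0 1) 2 +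
        fderiv ℝ (v z.1) y (EuclideanSpace.single 2 1) 1 * fderiv ℝ (v z.1) y (EuclideanSpace.single 1 1) 2 < 0}) :
    ∀ z ∈ W, ∃ c : EuclideanSpace ℝ (Fin 3), ∃ r : ℝ, 0 < r ∧ ∀ y ∈ ball c r,
      0 < fderiv ℝ (v z.1) y (EuclideanSpace.single 2 1) 0 * fderiv ℝ (v z.1) y (EuclideanSpace.single 0 1) 2 +
        fderiv ℝ (v z.1) y (EuclideanSpace.single 2 1) 1 * fderiv ℝ (v z.1) y (EuclideanSpace.single 1 1) 2 := by
  intro z hz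
  have ht : z.1 < 0 := (mem_prod.1 (hWs hz)).1
  exact exists_ellipticBall_of_not_dense hrate hcont hmild ht ⟨z.2, hhyp z hz⟩ (hpocket z hz)

/-- **`stub_zShockThickAut` / `stub_zShockThickMod`'s `hdense` read pointwise (window form).**  Class binders VERBATIM, a window
`W ⊆ {t < 0} × ℝ³`, a window point `z₀ ∈ W` whose slice is densely hyperbolic ⟹ the slice `t₀ = z₀.1` has NO strictly elliptic point:
`E(t₀, y) ≤ 0` for every `y ∈ ℝ³` (the slice is hyperbolic-or-degenerate at every point — the only non-hyperbolic points are zeros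
of the real-analytic discriminant, a closed set with empty interior). [folklore] -/
theorem hypDiscriminant_nonpos_of_denseSlice (C : ℝ) (v : ℝ → EuclideanSpace ℝ (Fin 3) → EuclideanSpace ℝ (Fin 3))
    (hrate : HasTypeITimeDecay C v) (hcont : ContinuousOn (uncurry v) (Iio (0 : ℝ) ×ˢ univ))
    (hmild : ∀ s t : ℝ, s < t → t < 0 → ∀ x, v t x =
      UnboundedOperators.heatExtension (v s) (t - s) x - oseenDuhamel 1 s v v t x)
    (W : Set (ℝ × EuclideanSpace ℝ (Fin 3))) (hWs : W ⊆ Iio (0 : ℝ) ×ˢ univ)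
    (z₀ : ℝ × EuclideanSpace ℝ (Fin 3)) (hz₀ : z₀ ∈ W)
    (hdense : Dense {y : EuclideanSpace ℝ (Fin 3) |
      fderiv ℝ (v z₀.1) y (EuclideanSpace.single 2 1) 0 * fderiv ℝ (v z₀.1) y (EuclideanSpace.single 0 1) 2 +
        fderiv ℝ (v z₀.1) y (EuclideanSpace.single 2 1) 1 * fderiv ℝ (v z₀.1) y (EuclideanSpace.single 1 1) 2 < 0}) :
    (∀ y : EuclideanSpace ℝ (Fin 3),
      fderiv ℝ (v z₀.1) y (EuclideanSpace.single 2 1) 0 * fderiv ℝ (v z₀.1) y (EuclideanSpace.single 0 1) 2 +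
        fderiv ℝ (v z₀.1) y (EuclideanSpace.single 2 1) 1 * fderiv ℝ (v z₀.1) y (EuclideanSpace.single 1 1) 2 ≤ 0) ∧
    interior {y : EuclideanSpace ℝ (Fin 3) |
      fderiv ℝ (v z₀.1) y (EuclideanSpace.single 2 1) 0 * fderiv ℝ (v z₀.1) y (EuclideanSpace.single 0 1) 2 +
        fderiv ℝ (v z₀.1) y (EuclideanSpace.single 2 1) 1 * fderiv ℝ (v z₀.1) y (EuclideanSpace.single 1 1) 2 = 0} = ∅ := by
  have ht : z₀.1 < 0 := (mem_prod.1 (hWs hz₀)).1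
  refine ⟨hypDiscriminant_nonpos_of_dense hrate hcont hmild ht hdense, ?_⟩
  -- the zero set misses the dense open set `{E < 0}`, so its interior is empty
  rw [← subset_empty_iff]
  intro y hy
  rw [mem_interior_iff_mem_nhds] at hy
  obtain ⟨r, hr, hball⟩ := Metric.mem_nhds_iff.1 hy
  obtain ⟨y', hy'⟩ := (dense_iff_inter_open.1 hdense) (ball y r) isOpen_ball ⟨y, mem_ball_self hr⟩
  have h0 : _ = (0 : ℝ) := hball hy'.1
  have hlt := hy'.2
  simp only [mem_setOf_eq] at hlt
  exact absurd h0 (ne_of_lt hlt)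

/-! ## Appendix (same seat, same session): the converse directions, so that BOTH skeleton predicates are pointwise statements -/

/-- A point with `E > 0` witnesses non-density of `{E < 0}` (continuity only). [folklore] -/
theorem not_dense_setOf_neg_of_pos {X : Type*} [TopologicalSpace X] {E : X → ℝ} (hE : Continuous E)
    {y : X} (hy : 0 < E y) : ¬ Dense {y | E y < 0} := fun hD =>
  absurd (nonpos_of_dense_setOf_neg hE hD y) (not_le.2 hy)

/-- **`¬ Dense {E < 0}` ⟺ some point with `E > 0`**, for a real-analytic `E` with one negative point (the ball of
`exists_ball_pos_of_not_dense_setOf_neg` in one direction, continuity in the other). [folklore] -/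
theorem not_dense_setOf_neg_iff_exists_pos {F : Type*} [NormedAddCommGroup F] [NormedSpace ℝ F] {E : F → ℝ}
    (hE : AnalyticOnNhd ℝ E univ) (hx : ∃ x₀, E x₀ < 0) : ¬ Dense {y | E y < 0} ↔ ∃ y, 0 < E y := by
  refine ⟨fun hnd => ?_, fun ⟨y, hy⟩ => not_dense_setOf_neg_of_pos hE.continuous hy⟩
  obtain ⟨c, r, hr, hball⟩ := exists_ball_pos_of_not_dense_setOf_neg hE hx hnd
  exact ⟨c, hball c (mem_ball_self hr)⟩

/-- **The skeleton's split of the thick hyperbolic column, read pointwise (class form).**  For a class profile (binders VERBATIM) and a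
slice `t < 0` carrying one strictly hyperbolic point:
`Dense {E(t,·) < 0}` ⟺ «no strictly elliptic point» (`∀ y, E(t,y) ≤ 0`), and `¬ Dense {E(t,·) < 0}` ⟺ «some strictly elliptic point»
(`∃ y, 0 < E(t,y)`).  Hence `zShockThick_of_autSplit`'s `hdense` / `stub_mixedPocketThick`'s `hpocket` are the dichotomy «SOME window time
has an elliptic-point-free slice» / «EVERY window-time slice has a strictly elliptic point». [folklore] -/
theorem dense_iff_noEllipticPoint_of_class {C : ℝ} {v : ℝ → EuclideanSpace ℝ (Fin 3) → EuclideanSpace ℝ (Fin 3)}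
    (hrate : HasTypeITimeDecay C v) (hcont : ContinuousOn (uncurry v) (Iio (0 : ℝ) ×ˢ univ))
    (hmild : ∀ s t : ℝ, s < t → t < 0 → ∀ x, v t x =
      UnboundedOperators.heatExtension (v s) (t - s) x - oseenDuhamel 1 s v v t x)
    {t : ℝ} (ht : t < 0)
    (hx : ∃ x₀ : EuclideanSpace ℝ (Fin 3),
      fderiv ℝ (v t) x₀ (EuclideanSpace.single 2 1) 0 * fderiv ℝ (v t) x₀ (EuclideanSpace.single 0 1) 2 +
        fderiv ℝ (v t) x₀ (EuclideanSpace.single 2 1) 1 * fderiv ℝ (v t) x₀ (EuclideanSpace.single 1 1) 2 < 0) :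
    (Dense {y : EuclideanSpace ℝ (Fin 3) |
        fderiv ℝ (v t) y (EuclideanSpace.single 2 1) 0 * fderiv ℝ (v t) y (EuclideanSpace.single 0 1) 2 +
          fderiv ℝ (v t) y (EuclideanSpace.single 2 1) 1 * fderiv ℝ (v t) y (EuclideanSpace.single 1 1) 2 < 0} ↔
      ∀ y : EuclideanSpace ℝ (Fin 3),
        fderiv ℝ (v t) y (EuclideanSpace.single 2 1) 0 * fderiv ℝ (v t) y (EuclideanSpace.single 0 1) 2 +
          fderiv ℝ (v t) y (EuclideanSpace.single 2 1) 1 * fderiv ℝ (v t) y (EuclideanSpace.single 1 1) 2 ≤ 0) ∧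
    (¬ Dense {y : EuclideanSpace ℝ (Fin 3) |
        fderiv ℝ (v t) y (EuclideanSpace.single 2 1) 0 * fderiv ℝ (v t) y (EuclideanSpace.single 0 1) 2 +
          fderiv ℝ (v t) y (EuclideanSpace.single 2 1) 1 * fderiv ℝ (v t) y (EuclideanSpace.single 1 1) 2 < 0} ↔
      ∃ y : EuclideanSpace ℝ (Fin 3),
        0 < fderiv ℝ (v t) y (EuclideanSpace.single 2 1) 0 * fderiv ℝ (v t) y (EuclideanSpace.single 0 1) 2 +
          fderiv ℝ (v t) y (EuclideanSpace.single 2 1) 1 * fderiv ℝ (v t) y (EuclideanSpace.single 1 1) 2) :=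
  ⟨dense_setOf_neg_iff_nonpos (analyticOnNhd_hypDiscriminant_slice hrate hcont hmild ht) hx,
    not_dense_setOf_neg_iff_exists_pos (analyticOnNhd_hypDiscriminant_slice hrate hcont hmild ht) hx⟩

end Summit.NavierStokesRegularity.NavierStokesRegularity.Theorems.PoloidalWindowDoorPoloidalWindowRigidityZShockEllipticPocket

end
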